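import Literature.NumberTheory.LFunctions.KloostermanFractionsOffDiagO
import HarnessLib

/-!
# Bilinear forms with Kloosterman fractions: the bound for `𝓒_b` on a dyadic `m`-range

Bettin–Chandee, *Trilinear forms with Kloosterman fractions* (arXiv:1502.00769), §§2–5 with
`A = 1`: the amplified second moment

  `𝓒_b(M₁,M₂;N',γ) = Σ_{M₁ < m ≤ M₂, (m,b)=1} |Σ_{n ≤ 2N', (n,m)=1} γ_n e(k m̄/(bn))|²`

is at most `(M₂/P²)(|Σ_m kfDiag(m)| + |Σ_m kfOff(m)|)` (amplification by the primes of `𝓛`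
coprime to `m`, at least `P` of them), and the two sums are bounded by `kfd_diag_bound` and
`kfO_le`.  Everything explicit; the choice of `L` is made later.

Main result: `kfCb_le`.

## References
* S. Bettin, V. Chandee, *Trilinear forms with Kloosterman fractions*, Adv. Math. 328 (2018),
  arXiv:1502.00769, §2 (amp), §5 (rve). [cite: BettinChandee2018, §5]
* W. Duke, J. Friedlander, H. Iwaniec, *Bilinear forms with Kloosterman fractions*,
  Invent. Math. 128 (1997) 23–43, §§3–5. [cite: DukeFriedlanderIwaniec1997, §5]
-/

noncomputable section

open Finset

namespace Literature.NumberTheory.LFunctions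

/-- **Amplification on a dyadic `m`-range** (variant of `kfC_le_diag_add_off`): if
`0 < P ≤ #{ℓ ∈ 𝓛 : (ℓ,m)=1}` for all `M₁ < m ≤ M₂` coprime to `b`, then
`Σ_{M₁<m≤M₂,(m,b)=1} |X_m|² ≤ (M₂/P²)(‖Σ_m kfDiag(m)‖ + ‖Σ_m kfOff(m)‖)`.
[cite: BettinChandee2018, §2 (amp)] -/
theorem kfCdy_le_diag_add_off (k : ℤ) (b : ℕ) (N' : ℝ) (γ : ℕ → ℂ) (𝓛 : Finset ℕ)
    (M₁ M₂ : ℕ) {P : ℝ} (hP : 0 < P)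
    (hP𝓛 : ∀ m ∈ (Ioc M₁ M₂).filter (fun m => m.Coprime b),
      P ≤ ((𝓛.filter (fun ℓ => ℓ.Coprime m)).card : ℝ)) :
    ∑ m ∈ (Ioc M₁ M₂).filter (fun m => m.Coprime b), ‖kfInner k b N' γ m‖ ^ 2 ≤
      (M₂ : ℝ) / P ^ 2 *
        (‖∑ m ∈ (Ioc M₁ M₂).filter (fun m => m.Coprime b), kfDiag k b N' γ 𝓛 m‖ +
          ‖∑ m ∈ (Ioc M₁ M₂).filter (fun m => m.Coprime b), kfOff k b N' γ 𝓛 m‖) := by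
  have hterm : ∀ m ∈ (Ioc M₁ M₂).filter (fun m => m.Coprime b),
      ‖kfInner k b N' γ m‖ ^ 2 ≤ (M₂ : ℝ) / P ^ 2 * (kfSigma k b N' γ 𝓛 m).re := by
    intro m hm
    have hm' := Finset.mem_filter.mp hm
    have hm1 : M₁ < m := (Finset.mem_Ioc.mp hm'.1).1
    have hm2 : m ≤ M₂ := (Finset.mem_Ioc.mp hm'.1).2
    have hm0 : 0 < m := by omega
    have h1 := norm_kfInner_sq_le k b N' γ 𝓛 hm0 hP (hP𝓛 m hm)
    have hre := (kfSigma_re_nonneg k b N' γ 𝓛 hm0).2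
    have hφ : (m.totient : ℝ) ≤ M₂ := by
      calc (m.totient : ℝ) ≤ m := by exact_mod_cast Nat.totient_le m
        _ ≤ M₂ := by exact_mod_cast hm2
    calc ‖kfInner k b N' γ m‖ ^ 2 ≤ (m.totient : ℝ) / P ^ 2 * (kfSigma k b N' γ 𝓛 m).re := h1
      _ ≤ (M₂ : ℝ) / P ^ 2 * (kfSigma k b N' γ 𝓛 m).re := by gcongr
  refine (Finset.sum_le_sum hterm).trans ?_
  rw [← Finset.mul_sum]
  refine mul_le_mul_of_nonneg_left ?_ (by positivity)
  rw [← Complex.re_sum]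
  simp_rw [kfSigma_eq_kfDiag_add_kfOff]
  rw [Finset.sum_add_distrib, Complex.add_re]
  exact add_le_add (Complex.re_le_norm _) (Complex.re_le_norm _)

/-- **The bound for `𝓒_b` on a dyadic range** (B–C (rve) with `A = 1`, our explicit constants,
`L` free): for `γ` supported on square-free `N' < n ≤ 2N'` coprime to `bk` (`(b,k) = 1`),
`𝓛` primes in `(L,2L]` coprime to `bk` with at least `P > 0` of them coprime to each `m`,

  `𝓒_b(M₁,M₂) ≤ (M₂/P²) ‖γ‖² (DIAG + T'·OFF)`,

`DIAG = #𝓛(M₂-M₁) + (log 2N'/log L)(4T'(M₂-M₁)/(bN') + 16T'²L(bLN')^{1/2}(1+log(4bLN')))`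
(`kfd_diag_bound`), `OFF = #𝓛·2N'(1+4 log 2N'/log L) + T'L(M₁+1)/2 + (LbΘ)^{1/2}` (`kfO_le`).
[cite: BettinChandee2018, §5 (rve)] -/
theorem kfCb_le (k : ℤ) {b : ℕ} (hb : 0 < b) (hkb : k.natAbs.Coprime b) (γ : ℕ → ℂ) {N' : ℝ}
    (hN' : 1 / 2 ≤ N')
    (hγ : ∀ n, γ n ≠ 0 → N' < n ∧ n.Coprime b ∧ Int.gcd k n = 1 ∧ Squarefree n)
    {L : ℕ} (hL : 2 ≤ L) (𝓛 : Finset ℕ)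
    (h𝓛 : ∀ ℓ ∈ 𝓛, ℓ.Prime ∧ L < ℓ ∧ ℓ ≤ 2 * L ∧ ℓ.Coprime b ∧ Int.gcd k ℓ = 1)
    {M₁ M₂ : ℕ} (hM : M₁ ≤ M₂) {P : ℝ} (hP : 0 < P)
    (hP𝓛 : ∀ m ∈ (Ioc M₁ M₂).filter (fun m => m.Coprime b),
      P ≤ ((𝓛.filter (fun ℓ => ℓ.Coprime m)).card : ℝ))
    {T' : ℝ} (hγτ : ∀ n, γ n ≠ 0 → (((b * n).divisors.card : ℕ) : ℝ) ≤ T')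
    (hT' : ∀ w : ℕ, 1 ≤ w → (w : ℝ) ≤ 16 * (L : ℝ) ^ 2 *
      (N' + (⌈4 * (L : ℝ) * N' / ((M₁ : ℝ) + 1)⌉₊ : ℝ)) + 2 * b * N' → (w.divisors.card : ℝ) ≤ T') :
    ∑ m ∈ (Ioc M₁ M₂).filter (fun m => m.Coprime b), ‖kfInner k b N' γ m‖ ^ 2 ≤
      (M₂ : ℝ) / P ^ 2 * (∑ n ∈ Icc 1 ⌊2 * N'⌋₊, ‖γ n‖ ^ 2) *
        ((𝓛.card * ((M₂ : ℝ) - M₁) + Real.log (2 * N') / Real.log L *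
          (4 * T' * ((M₂ : ℝ) - M₁) / (b * N') +
            16 * T' ^ 2 * L * Real.sqrt (b * L * N') * (1 + Real.log (4 * (b * L * N'))))) +
        T' * ((𝓛.card : ℝ) * (2 * N') * (1 + 4 * (Real.log (2 * N') / Real.log L)) +
          (T' * L * ((M₁ : ℝ) + 1) / 2 +
            Real.sqrt ((L : ℝ) * b * ((L : ℝ) *
              (32 * (L : ℝ) ^ 2 * N' ^ 2 * (((M₂ : ℝ) - M₁) / L + 1) / ((M₁ : ℝ) + 1) +
                6144 * T' ^ 2 * (L : ℝ) ^ 4 * N' ^ 3 *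
                  (1 + 64 * Real.pi * |(k : ℝ)| / ((b : ℝ) * ((M₁ : ℝ) + 1) * N')) *
                  (9 + T' * L * Real.sqrt (8 * N') * (1 + Real.log (8 * (L : ℝ) ^ 2 * N'))) /
                  ((M₁ : ℝ) + 1) ^ 2)))))) := by
  have hN'0 : 0 < N' := by linarith
  have he : ∀ (k : ℤ) (q m : ℕ), kfPhase k q m = Complex.exp (2 * Real.pi * Complex.I *
      ((k : ℂ) * ((((m : ZMod q)⁻¹).val : ℕ) : ℂ) / (q : ℂ))) := fun _ _ _ => rfl
  have hγτ' : ∀ n, γ n ≠ 0 → (n.divisors.card : ℝ) ≤ T' := by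
    intro n hn
    refine le_trans ?_ (hγτ n hn)
    have hn0 : n ≠ 0 := by
      rintro rfl
      have := (hγ 0 hn).1; simp at this; linarith
    exact_mod_cast Finset.card_le_card (Nat.divisors_subset_of_dvd (by positivity)
      (dvd_mul_left n b))
  -- diagonal
  have hdiag := kfd_diag_bound kfPhase he k hb hL hkb 𝓛
    (fun ℓ hℓ => ⟨(h𝓛 ℓ hℓ).1, (h𝓛 ℓ hℓ).2.1, (h𝓛 ℓ hℓ).2.2.1, by
      have h := (h𝓛 ℓ hℓ).2.2.2.2
      rw [Int.gcd_eq_natAbs, Int.natAbs_natCast] at h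
      exact Nat.Coprime.symm h⟩) hN'0 γ
    (fun n hn => ⟨(hγ n hn).1, by
      have h := (hγ n hn).2.2.1
      rw [Int.gcd_eq_natAbs, Int.natAbs_natCast] at h
      exact Nat.Coprime.symm h, hγτ n hn⟩) hM
  have hdiag' : ‖∑ m ∈ (Ioc M₁ M₂).filter (fun m => m.Coprime b), kfDiag k b N' γ 𝓛 m‖ ≤ _ :=
    hdiag
  -- off-diagonal
  have hoff := kfO_le k hb γ hN' hγ hL 𝓛 h𝓛 hM hγτ' hT'
  have h1 := kfCdy_le_diag_add_off k b N' γ 𝓛 M₁ M₂ hP hP𝓛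
  refine h1.trans ?_
  have hG0 : 0 ≤ ∑ n ∈ Icc 1 ⌊2 * N'⌋₊, ‖γ n‖ ^ 2 := Finset.sum_nonneg fun n _ => by positivity
  rw [mul_assoc]
  refine mul_le_mul_of_nonneg_left ?_ (by positivity)
  rw [mul_add]
  exact add_le_add hdiag' (by
    have := hoff
    calc _ ≤ _ := this
      _ = _ := by ring)

end Literature.NumberTheory.LFunctions

end
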